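import Summits.RiemannHypothesis.RiemannHypothesis.Theorems.WeilGroundStateMarkovPartPositiveGroundStatePairs

/-!
# Markov part of Weil's form: `|u|` is a minimiser and the phase of a minimiser is constant

Support file for item `MarkovPartPositiveGroundState` of route `WeilGroundState` (the reduction
of complex ground states to the non-negative one; Reed–Simon XIII.44, proof of (c) ⇒ (a), last
paragraph, done variationally for the jump form `𝓔_a`).

* `weilIncrement_congr_ae`, `weilDirichletEnergy_congr_ae`: the energy only sees a.e. classes.
* `finiteEnergy_norm`, `weilDirichletEnergy_norm_le`: `x ↦ |u(x)|` has finite energy and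
  `𝓔_a(|u|) ≤ 𝓔_a(u)` (the modulus is a `1`-Lipschitz contraction, `weilDirichletEnergy_comp_le`).
* `phase_rigidity`: if `u` is a normalised minimiser (`𝓔_a(u) ≤ E`, `E` the bottom on the form
  domain) whose modulus is a.e. positive on the window, then `u = c |u|` a.e. for a constant phase
  `|c| = 1`: the deficit `|u(y) − u(x)|² − (|u(y)| − |u(x)|)² ≥ 0` must vanish for a.e. pair (the
  jump density charges every length), i.e. `u(y) conj u(x) ≥ 0` a.e., and one good base point `x₀`
  fixes the phase.
-/

-- `Summit.RiemannHypothesis.RiemannHypothesis.…` repeats the summit name by design (D-0017 layout).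
set_option linter.dupNamespace false

noncomputable section

open MeasureTheory Set Filter
open scoped Topology ENNReal NNReal ComplexConjugate

namespace Summit.RiemannHypothesis.RiemannHypothesis.Theorems.WeilGroundStateMarkovPart

open Literature.NumberTheory.LFunctions
open Summit.RiemannHypothesis.RiemannHypothesis.Theorems.WeilWindowFlowWindowLipschitz

/-! ## The energy only depends on the a.e. class -/

/-- `D_t` only depends on the a.e. class of the function. -/
theorem weilIncrement_congr_ae {u v : ℝ → ℂ} (h : u =ᵐ[volume] v) :
    weilIncrement u = weilIncrement v := by
  funext t
  unfold weilIncrement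
  refine integral_congr_ae ?_
  have htr : (fun x ↦ u (x + t)) =ᵐ[volume] fun x ↦ v (x + t) :=
    (measurePreserving_add_right volume t).quasiMeasurePreserving.ae_eq_comp h
  filter_upwards [h, htr] with x h1 h2
  have h2' : u (x + t) = v (x + t) := h2
  simp only [h1, h2']

/-- `𝓔_a` only depends on the a.e. class of the function. -/
theorem weilDirichletEnergy_congr_ae (a : ℝ) {u v : ℝ → ℂ} (h : u =ᵐ[volume] v) :
    weilDirichletEnergy a u = weilDirichletEnergy a v := by
  simp only [weilDirichletEnergy, weilIncrement_congr_ae h]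

/-! ## The modulus is a minimiser -/

/-- The modulus map `z ↦ |z|` (into `ℂ`) is `1`-Lipschitz. -/
theorem lipschitzWith_one_ofReal_norm : LipschitzWith 1 fun z : ℂ ↦ ((‖z‖ : ℝ) : ℂ) := by
  refine LipschitzWith.of_dist_le_mul fun z w ↦ ?_
  rw [NNReal.coe_one, one_mul, Complex.dist_eq, ← Complex.ofReal_sub, Complex.norm_real,
    Real.norm_eq_abs, Complex.dist_eq]
  exact abs_norm_sub_norm_le z w

/-- `D_t(|u|) ≤ D_t(u)` for `u ∈ L²`. -/
theorem weilIncrement_norm_le {u : ℝ → ℂ} (hu : MemLp u 2) (t : ℝ) :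
    weilIncrement (fun x ↦ ((‖u x‖ : ℝ) : ℂ)) t ≤ weilIncrement u t := by
  have := weilIncrement_comp_le (g := u) lipschitzWith_one_ofReal_norm
    (integrable_weilIncrement_integrand hu t)
  exact this

/-- The modulus of a square integrable function is square integrable (complex embedding). -/
theorem memLp_ofReal_norm {u : ℝ → ℂ} (hu : MemLp u 2) : MemLp (fun x ↦ ((‖u x‖ : ℝ) : ℂ)) 2 := by
  refine MemLp.of_le hu (Complex.continuous_ofReal.comp_aestronglyMeasurable hu.1.norm)
    (Eventually.of_forall fun x ↦ ?_)
  simp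

/-- **Finite energy of the modulus**: if `t ↦ ρ(t) D_t(u)` is integrable on `(0, ∞)` then so is
`t ↦ ρ(t) D_t(|u|)`. -/
theorem finiteEnergy_norm {u : ℝ → ℂ} (hu : MemLp u 2)
    (hfin : IntegrableOn (fun t ↦ weilArchDensity t * weilIncrement u t) (Ioi 0)) :
    IntegrableOn (fun t ↦ weilArchDensity t * weilIncrement (fun x ↦ ((‖u x‖ : ℝ) : ℂ)) t)
      (Ioi 0) := by
  refine Integrable.mono' hfin (measurable_weilArchDensity.aestronglyMeasurable.mul
    (stub_localizedCut_aesm_weilIncrement (memLp_ofReal_norm hu).1)).restrict ?_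
  refine (ae_restrict_iff' measurableSet_Ioi).2 (Eventually.of_forall fun t (ht : 0 < t) ↦ ?_)
  rw [Real.norm_of_nonneg (mul_nonneg (weilArchDensity_pos ht).le (weilIncrement_nonneg _ t))]
  exact mul_le_mul_of_nonneg_left (weilIncrement_norm_le hu t) (weilArchDensity_pos ht).le

/-- **`𝓔_a(|u|) ≤ 𝓔_a(u)`** (first Beurling–Deny contraction for the jump form; tree lemma
`weilDirichletEnergy_comp_le` with the `1`-Lipschitz modulus). -/
theorem weilDirichletEnergy_norm_le (a : ℝ) {u : ℝ → ℂ} (hu : MemLp u 2)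
    (hfin : IntegrableOn (fun t ↦ weilArchDensity t * weilIncrement u t) (Ioi 0)) :
    weilDirichletEnergy a (fun x ↦ ((‖u x‖ : ℝ) : ℂ)) ≤ weilDirichletEnergy a u := by
  have := weilDirichletEnergy_comp_le (g := u) lipschitzWith_one_ofReal_norm a
    (integrable_weilIncrement_integrand hu) hfin
  exact this

/-! ## Phase rigidity -/

/-- A complex number whose real part equals its modulus is that modulus. -/
theorem eq_norm_of_re_eq_norm {z : ℂ} (h : z.re = ‖z‖) : z = (‖z‖ : ℂ) := by
  have him : z.im = 0 := by
    have h1 : ‖z‖ ^ 2 = z.re ^ 2 + z.im ^ 2 := by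
      rw [← Complex.normSq_eq_norm_sq, Complex.normSq_apply]; ring
    rw [← h] at h1
    nlinarith [sq_nonneg z.im]
  apply Complex.ext
  · simpa using h
  · simp [him]

/-- **Phase rigidity of a minimiser.** Let `E` be the bottom of `𝓔_a` on the form domain of the
window (`E ∫|v|² ≤ 𝓔_a(v)` there) and `u` measurable, square integrable, vanishing off `[-a, a]`,
with `∫ |u|² = 1`, finite archimedean energy and `𝓔_a(u) ≤ E`, and suppose `|u| > 0` a.e. on
`(-a, a)` (`a > 0`). Then `u = c|u|` a.e. for a constant `c` with `|c| = 1`. -/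
theorem phase_rigidity {a E : ℝ} (ha : 0 < a) {u : ℝ → ℂ} (hum : Measurable u) (hu : MemLp u 2)
    (hs : ∀ x, x ∉ Icc (-a) a → u x = 0) (hn : ∫ x, ‖u x‖ ^ 2 = 1)
    (hfin : IntegrableOn (fun t ↦ weilArchDensity t * weilIncrement u t) (Ioi 0))
    (hE : weilDirichletEnergy a u ≤ E)
    (hbot : ∀ v : ℝ → ℂ, MemLp v 2 → (∀ x, x ∉ Icc (-a) a → v x = 0) →
      IntegrableOn (fun t ↦ weilArchDensity t * weilIncrement v t) (Ioi 0) →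
      E * ∫ x, ‖v x‖ ^ 2 ≤ weilDirichletEnergy a v)
    (hpos : ∀ᵐ x : ℝ, x ∈ Ioo (-a) a → 0 < ‖u x‖) :
    ∃ c : ℂ, ‖c‖ = 1 ∧ u =ᵐ[volume] fun x ↦ c * ((‖u x‖ : ℝ) : ℂ) := by
  -- the modulus and the deficit
  set M : ℝ → ℂ := fun x ↦ ((‖u x‖ : ℝ) : ℂ) with hMdef
  set F : ℝ → ℝ → ℝ := fun x y ↦ ‖u y - u x‖ ^ 2 - (‖u y‖ - ‖u x‖) ^ 2 with hFdef
  have hF0 : ∀ x y, 0 ≤ F x y := fun x y ↦ by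
    simp only [hFdef, sub_nonneg]
    have h := abs_norm_sub_norm_le (u y) (u x)
    calc (‖u y‖ - ‖u x‖) ^ 2 = |‖u y‖ - ‖u x‖| ^ 2 := (sq_abs _).symm
      _ ≤ ‖u y - u x‖ ^ 2 := pow_le_pow_left₀ (abs_nonneg _) h 2
  have hFsymm : ∀ x y, F x y = F y x := fun x y ↦ by
    simp only [hFdef, norm_sub_rev (u y) (u x)]
    ring
  have hFm : Measurable (Function.uncurry F) := by
    have e : Function.uncurry F = fun p : ℝ × ℝ ↦
        ‖u p.2 - u p.1‖ ^ 2 - (‖u p.2‖ - ‖u p.1‖) ^ 2 := by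
      funext p; rfl
    rw [e]
    have h1 : Measurable fun p : ℝ × ℝ ↦ u p.1 := hum.comp measurable_fst
    have h2 : Measurable fun p : ℝ × ℝ ↦ u p.2 := hum.comp measurable_snd
    fun_prop
  have hid : ∀ x y, ‖M y - M x‖ ^ 2 + F x y = 1 * ‖u y - u x‖ ^ 2 + 0 * ‖u y - u x‖ ^ 2 := by
    intro x y
    simp only [hMdef, hFdef]
    rw [← Complex.ofReal_sub, Complex.norm_real, Real.norm_eq_abs, sq_abs]
    ring
  have hMc : MemLp M 2 := memLp_ofReal_norm hu
  have hMnorm : ∫ x, ‖M x‖ ^ 2 = 1 := by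
    rw [← hn]
    refine integral_congr_ae (Eventually.of_forall fun x ↦ ?_)
    simp [hMdef]
  have hMs : ∀ x, x ∉ Icc (-a) a → M x = 0 := fun x hx ↦ by simp [hMdef, hs x hx]
  obtain ⟨hfinM, hdef⟩ := lintegral_deficit_le (a := a) hMc hu hu hF0 hid hfin hfin
  have hEM : E * 1 ≤ weilDirichletEnergy a M := by
    have := hbot _ hMc hMs hfinM
    rwa [hMnorm] at this
  have hzero : ∫⁻ t in Ioi (0 : ℝ), ∫⁻ x, ENNReal.ofReal (weilArchDensity t * F x (x + t)) = 0 := by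
    refine le_antisymm (hdef.trans ?_) bot_le
    rw [ENNReal.ofReal_of_nonpos (by linarith)]
  -- a.e. pairs: `u(y) conj u(x) ≥ 0`
  have hae : ∀ᵐ x : ℝ, ∀ᵐ y : ℝ, ENNReal.ofReal (F x y) = 0 :=
    ae_pair_eq_zero_of_ae_lintegral_shift (F := fun x y ↦ ENNReal.ofReal (F x y))
      (ENNReal.measurable_ofReal.comp hFm) (fun x y ↦ by rw [hFsymm])
      (ae_lintegral_shift_eq_zero hFm hF0 hzero)
  have hprod : ∀ᵐ x : ℝ, ∀ᵐ y : ℝ, u y * conj (u x) = (((‖u y‖ * ‖u x‖ : ℝ)) : ℂ) := by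
    filter_upwards [hae] with x hx
    filter_upwards [hx] with y hy
    have hF00 : F x y = 0 := le_antisymm (ENNReal.ofReal_eq_zero.1 hy) (hF0 x y)
    have hre : (u y * conj (u x)).re = ‖u y * conj (u x)‖ := by
      rw [norm_mul, Complex.norm_conj]
      have e1 : ‖u y - u x‖ ^ 2 = ‖u y‖ ^ 2 + ‖u x‖ ^ 2 - 2 * (u y * conj (u x)).re := by
        rw [← Complex.normSq_eq_norm_sq, ← Complex.normSq_eq_norm_sq, ← Complex.normSq_eq_norm_sq,
          Complex.normSq_sub]
      simp only [hFdef] at hF00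
      nlinarith [e1, hF00]
    have := eq_norm_of_re_eq_norm hre
    rw [this, norm_mul, Complex.norm_conj]
  -- a good base point
  obtain ⟨x₀, -, hx₀, hq⟩ : ∃ x₀ ∈ Ioo (-a) a, 0 < ‖u x₀‖ ∧
      ∀ᵐ y : ℝ, u y * conj (u x₀) = (((‖u y‖ * ‖u x₀‖ : ℝ)) : ℂ) := by
    by_contra hne
    have hne' : ∀ x ∈ Ioo (-a) a, 0 < ‖u x‖ →
        (∀ᵐ y : ℝ, u y * conj (u x) = (((‖u y‖ * ‖u x‖ : ℝ)) : ℂ)) → False :=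
      fun x hx h1 h2 ↦ hne ⟨x, hx, h1, h2⟩
    have hnull : volume (Ioo (-a) a) = 0 := by
      rw [measure_eq_zero_iff_ae_notMem]
      filter_upwards [hpos, hprod] with x hx1 hx2 hxI
      exact hne' x hxI (hx1 hxI) hx2
    rw [Real.volume_Ioo] at hnull
    have : (0 : ℝ) < a - -a := by linarith
    exact absurd hnull (ENNReal.ofReal_pos.2 this).ne'
  have hux₀ : conj (u x₀) ≠ 0 := by
    rw [map_ne_zero_iff _ (RingHom.injective _)]
    exact norm_pos_iff.1 hx₀
  refine ⟨((‖u x₀‖ : ℝ) : ℂ) / conj (u x₀), ?_, ?_⟩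
  · rw [norm_div, Complex.norm_conj, Complex.norm_real, Real.norm_of_nonneg (norm_nonneg _),
      div_self hx₀.ne']
  · filter_upwards [hq] with y hy
    calc u y = u y * conj (u x₀) / conj (u x₀) := by rw [mul_div_cancel_right₀ _ hux₀]
      _ = (((‖u y‖ * ‖u x₀‖ : ℝ)) : ℂ) / conj (u x₀) := by rw [hy]
      _ = ((‖u x₀‖ : ℝ) : ℂ) / conj (u x₀) * ((‖u y‖ : ℝ) : ℂ) := by
          push_cast
          ring

end Summit.RiemannHypothesis.RiemannHypothesis.Theorems.WeilGroundStateMarkovPart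

end
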